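import Summits.AtomisticToContinuum.BoseEinsteinCondensation.Theorems.BECCutLineWeakDisorderLandscapeBoundSiblingDefs
import HarnessLib

/-!
# Route `BECCutLineWeakDisorder`, crux `LandscapeBound` (stmt-AtomisticToContinuum-9087),
# line `sibling-telescoping-chaining`: the Hölder weights and the allowance bookkeeping
# (registered bookkeeping stub `stub_weights`)

Support file (`--supports stmt-AtomisticToContinuum-9087`; proves the registered bookkeeping stub
`stub_weights : Goal.stub_weights`, statement `HolderWeightsBound` of
`Theorems/BECCutLineWeakDisorderLandscapeBoundSiblingDefs.lean`).

* `levelExponent_le`, `levelExponent_le_left` — `λ_{jk} ≤ (2π²/3)·min((j+1)², (k+1)²)`;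
* `sum_holderWeight_le` — the two-sided Hölder weights of `K` levels sum to `≤ 1` (Basel, twice);
* `sum_holderWeight_mul_levelBudget_le` — the total exponent produced by the chaining lemma is
  `≤ A(8 + 32π²)` uniformly in the depth `K` (geometric–polynomial sums);
* `stub_weights` — the registered stub;
* `levelBound_of_free` — a level with `7 ≤ A(2^{-j} + 2^{-k})(1 + λ_{jk})` is free: any variable
  `X ≤ 7` satisfies the level bound; `rpow_half_le_add_one` — `z^{1/2} ≤ z + 1` (both used by the
  composition).
-/

noncomputable section

open MeasureTheory Filter Set Finset
open scoped ENNReal NNReal Topology BigOperators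

namespace Summit.AtomisticToContinuum.BoseEinsteinCondensation.Cruxes.LandscapeBound.SiblingTelescopingChaining

/-! ### Bounds on the weights -/

/-- `θ_{jk} ≥ 3/(π²(k+1)²)`, hence `λ_{jk} ≤ (2π²/3)(k+1)²`. [folklore] -/
theorem levelExponent_le (j k : ℕ) :
    levelExponent j k ≤ 2 * Real.pi ^ 2 / 3 * ((k : ℝ) + 1) ^ 2 := by
  have hpi : 0 < Real.pi ^ 2 := by positivity
  have hk : (0 : ℝ) < ((k : ℝ) + 1) ^ 2 := by positivity
  have hlow : 3 / (Real.pi ^ 2 * ((k : ℝ) + 1) ^ 2) ≤ holderWeight j k := by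
    unfold holderWeight
    have : 0 ≤ 3 / (Real.pi ^ 2 * ((j : ℝ) + 1) ^ 2) := by positivity
    linarith
  unfold levelExponent
  rw [div_le_iff₀ (holderWeight_pos j k)]
  calc (2 : ℝ) = 2 * Real.pi ^ 2 / 3 * ((k : ℝ) + 1) ^ 2 * (3 / (Real.pi ^ 2 * ((k : ℝ) + 1) ^ 2)) := by
        field_simp
    _ ≤ 2 * Real.pi ^ 2 / 3 * ((k : ℝ) + 1) ^ 2 * holderWeight j k := by
        gcongr

/-- `θ_{jk}` is symmetric, hence also `λ_{jk} ≤ (2π²/3)(j+1)²`. [folklore] -/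
theorem holderWeight_comm (j k : ℕ) : holderWeight j k = holderWeight k j := by
  unfold holderWeight; ring

/-- Hence also `λ_{jk} ≤ (2π²/3)(j+1)²`. -/
theorem levelExponent_le_left (j k : ℕ) :
    levelExponent j k ≤ 2 * Real.pi ^ 2 / 3 * ((j : ℝ) + 1) ^ 2 := by
  have h := levelExponent_le k j
  unfold levelExponent at h ⊢
  rwa [holderWeight_comm]

/-- Basel partial sums: `Σ_{k<K} 1/(k+1)² ≤ π²/6`. [folklore] -/
theorem sum_inv_sq_le (K : ℕ) : ∑ k ∈ range K, (1 : ℝ) / ((k : ℝ) + 1) ^ 2 ≤ Real.pi ^ 2 / 6 := by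
  have h := hasSum_zeta_two
  have h2 : ∑ k ∈ range K, (1 : ℝ) / ((k : ℝ) + 1) ^ 2 =
      ∑ m ∈ Finset.Ico 1 (K + 1), (1 : ℝ) / (m : ℝ) ^ 2 := by
    rw [Finset.range_eq_Ico, ← Finset.sum_Ico_add' (fun m : ℕ => (1:ℝ) / (m : ℝ) ^ 2) 0 K 1]
    refine Finset.sum_congr rfl fun k _ => ?_
    push_cast
    ring
  rw [h2]
  exact sum_le_hasSum _ (fun m _ => by positivity) h

/-- The two-sided weights of `K` levels sum to at most `1`. [folklore] -/
theorem sum_holderWeight_le (K : ℕ) :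
    ∑ j ∈ range K, holderWeight j (K - 1 - j) ≤ 1 := by
  have hpi : 0 < Real.pi ^ 2 := by positivity
  have h1 : ∑ j ∈ range K, 3 / (Real.pi ^ 2 * ((j : ℝ) + 1) ^ 2) ≤ 1 / 2 := by
    have : ∑ j ∈ range K, 3 / (Real.pi ^ 2 * ((j : ℝ) + 1) ^ 2) =
        3 / Real.pi ^ 2 * ∑ j ∈ range K, (1 : ℝ) / ((j : ℝ) + 1) ^ 2 := by
      rw [Finset.mul_sum]
      refine Finset.sum_congr rfl fun j _ => ?_
      field_simp
    rw [this]
    calc 3 / Real.pi ^ 2 * ∑ j ∈ range K, (1 : ℝ) / ((j : ℝ) + 1) ^ 2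
        ≤ 3 / Real.pi ^ 2 * (Real.pi ^ 2 / 6) := by gcongr; exact sum_inv_sq_le K
      _ = 1 / 2 := by field_simp; ring
  have h2 : ∑ j ∈ range K, 3 / (Real.pi ^ 2 * (((K - 1 - j : ℕ) : ℝ) + 1) ^ 2) ≤ 1 / 2 := by
    rw [Finset.sum_range_reflect (fun j => 3 / (Real.pi ^ 2 * ((j : ℝ) + 1) ^ 2)) K]
    exact h1
  calc ∑ j ∈ range K, holderWeight j (K - 1 - j)
      = ∑ j ∈ range K, 3 / (Real.pi ^ 2 * ((j : ℝ) + 1) ^ 2) +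
          ∑ j ∈ range K, 3 / (Real.pi ^ 2 * (((K - 1 - j : ℕ) : ℝ) + 1) ^ 2) := by
        rw [← Finset.sum_add_distrib]
        rfl
    _ ≤ 1 / 2 + 1 / 2 := add_le_add h1 h2
    _ = 1 := by norm_num

/-! ### Geometric bookkeeping of the allowances -/

/-- `Σ_{k<K} 2^{-k} ≤ 2`. -/
theorem sum_geom_half_le (K : ℕ) : ∑ k ∈ range K, ((2 : ℝ)⁻¹) ^ k ≤ 2 := by
  have h : ∑ k ∈ range K, ((2 : ℝ)⁻¹) ^ k = ((2:ℝ)⁻¹ ^ K - 1) / (2⁻¹ - 1) :=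
    geom_sum_eq (x := (2:ℝ)⁻¹) (by norm_num) K
  rw [h, div_le_iff_of_neg (by norm_num)]
  have : (0:ℝ) ≤ (2:ℝ)⁻¹ ^ K := by positivity
  linarith

/-- Closed form of `Σ_{k<K} (k+1)² 2^{-k}`. -/
theorem sum_sq_geom_half_eq (K : ℕ) :
    ∑ k ∈ range K, ((k : ℝ) + 1) ^ 2 * ((2 : ℝ)⁻¹) ^ k =
      12 - (2 * (K : ℝ) ^ 2 + 8 * K + 12) * ((2 : ℝ)⁻¹) ^ K := by
  induction K with
  | zero => simp
  | succ K ih =>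
    rw [Finset.sum_range_succ, ih, pow_succ]
    push_cast
    ring

/-- `Σ_{k<K} (k+1)² 2^{-k} ≤ 12`. -/
theorem sum_sq_geom_half_le (K : ℕ) :
    ∑ k ∈ range K, ((k : ℝ) + 1) ^ 2 * ((2 : ℝ)⁻¹) ^ k ≤ 12 := by
  rw [sum_sq_geom_half_eq]
  have : (0:ℝ) ≤ (2 * (K : ℝ) ^ 2 + 8 * K + 12) * ((2 : ℝ)⁻¹) ^ K := by positivity
  linarith

/-- One geometric-polynomial sum: `Σ_{i<K} 2^{-i}(1 + (2π²/3)(i+1)²) ≤ 2 + 8π²`. [folklore] -/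
theorem sum_geom_poly_le (K : ℕ) :
    ∑ i ∈ range K, ((2 : ℝ)⁻¹) ^ i * (1 + 2 * Real.pi ^ 2 / 3 * ((i : ℝ) + 1) ^ 2) ≤
      2 + 8 * Real.pi ^ 2 := by
  have h1 := sum_geom_half_le K
  have h2 := sum_sq_geom_half_le K
  have heq : ∑ i ∈ range K, ((2 : ℝ)⁻¹) ^ i * (1 + 2 * Real.pi ^ 2 / 3 * ((i : ℝ) + 1) ^ 2) =
      ∑ i ∈ range K, ((2 : ℝ)⁻¹) ^ i +
        2 * Real.pi ^ 2 / 3 * ∑ i ∈ range K, ((i : ℝ) + 1) ^ 2 * ((2 : ℝ)⁻¹) ^ i := by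
    rw [Finset.mul_sum, ← Finset.sum_add_distrib]
    refine Finset.sum_congr rfl fun i _ => ?_
    ring
  rw [heq]
  have hpi : 0 ≤ 2 * Real.pi ^ 2 / 3 := by positivity
  nlinarith

/-- The total exponent produced by the chaining lemma is bounded uniformly in the number of
levels: `Σ_{j<K} θ_{j,K-1-j} B_{j,K-1-j} ≤ A (8 + 32π²)`. [folklore] -/
theorem sum_holderWeight_mul_levelBudget_le {A : ℝ} (hA : 0 ≤ A) (K : ℕ) :
    ∑ j ∈ range K, holderWeight j (K - 1 - j) * levelBudget A j (K - 1 - j) ≤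
      A * (8 + 32 * Real.pi ^ 2) := by
  -- θ B = 2·allowance·(1 + λ) ≤ 2A [2^{-j}(1 + c(j+1)²) + 2^{-k}(1 + c(k+1)²)]
  have hterm : ∀ j k : ℕ, holderWeight j k * levelBudget A j k ≤
      2 * A * (((2 : ℝ)⁻¹) ^ j * (1 + 2 * Real.pi ^ 2 / 3 * ((j : ℝ) + 1) ^ 2)) +
      2 * A * (((2 : ℝ)⁻¹) ^ k * (1 + 2 * Real.pi ^ 2 / 3 * ((k : ℝ) + 1) ^ 2)) := by
    intro j k
    have h := holderWeight_mul_levelExponent j k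
    have hl := levelExponent_le_left j k
    have hr := levelExponent_le j k
    have hlpos := (levelExponent_pos j k).le
    have heq : holderWeight j k * levelBudget A j k =
        2 * A * ((2 : ℝ)⁻¹ ^ j * (1 + levelExponent j k)) +
        2 * A * ((2 : ℝ)⁻¹ ^ k * (1 + levelExponent j k)) := by
      unfold levelBudget allowance
      calc holderWeight j k * (A * ((2 : ℝ)⁻¹ ^ j + (2 : ℝ)⁻¹ ^ k) *
            (levelExponent j k + levelExponent j k ^ 2))
          = (holderWeight j k * levelExponent j k) * A * ((2 : ℝ)⁻¹ ^ j + (2 : ℝ)⁻¹ ^ k) *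
              (1 + levelExponent j k) := by ring
        _ = _ := by rw [h]; ring
    rw [heq]
    have h2j : (0 : ℝ) ≤ (2 : ℝ)⁻¹ ^ j := by positivity
    have h2k : (0 : ℝ) ≤ (2 : ℝ)⁻¹ ^ k := by positivity
    gcongr
  calc ∑ j ∈ range K, holderWeight j (K - 1 - j) * levelBudget A j (K - 1 - j)
      ≤ ∑ j ∈ range K, (2 * A * (((2 : ℝ)⁻¹) ^ j * (1 + 2 * Real.pi ^ 2 / 3 * ((j : ℝ) + 1) ^ 2)) +
          2 * A * (((2 : ℝ)⁻¹) ^ (K - 1 - j) *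
            (1 + 2 * Real.pi ^ 2 / 3 * (((K - 1 - j : ℕ) : ℝ) + 1) ^ 2))) :=
        Finset.sum_le_sum fun j _ => hterm j (K - 1 - j)
    _ = 2 * A * ∑ j ∈ range K, ((2 : ℝ)⁻¹) ^ j * (1 + 2 * Real.pi ^ 2 / 3 * ((j : ℝ) + 1) ^ 2) +
          2 * A * ∑ j ∈ range K, ((2 : ℝ)⁻¹) ^ (K - 1 - j) *
            (1 + 2 * Real.pi ^ 2 / 3 * (((K - 1 - j : ℕ) : ℝ) + 1) ^ 2) := by
        rw [Finset.sum_add_distrib, Finset.mul_sum, Finset.mul_sum]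
    _ ≤ 2 * A * (2 + 8 * Real.pi ^ 2) + 2 * A * (2 + 8 * Real.pi ^ 2) := by
        have hA2 : 0 ≤ 2 * A := by positivity
        refine add_le_add (mul_le_mul_of_nonneg_left (sum_geom_poly_le K) hA2)
          (mul_le_mul_of_nonneg_left ?_ hA2)
        rw [Finset.sum_range_reflect
          (fun i => ((2 : ℝ)⁻¹) ^ i * (1 + 2 * Real.pi ^ 2 / 3 * ((i : ℝ) + 1) ^ 2)) K]
        exact sum_geom_poly_le K
    _ = A * (8 + 32 * Real.pi ^ 2) := by ring

/-! ### The registered bookkeeping stub -/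

/-- PROVED bookkeeping stub `stub_weights` (`HolderWeightsBound`). -/
theorem stub_weights : Goal.stub_weights :=
  ⟨sum_holderWeight_le, fun _ hA K => sum_holderWeight_mul_levelBudget_le hA K⟩

/-! ### Two lemmas for the composition -/

/-- **Free levels are free**: at a level with `7 ≤ A (2^{-j} + 2^{-k})(1 + λ_{jk})` the per-level
exponential-moment bound holds for ANY law of a variable `X ≤ 7`, in particular for the sibling
excess of any state. [folklore] -/
theorem levelBound_of_free {Ω : Type*} [MeasurableSpace Ω] (μ : Measure Ω)
    [IsProbabilityMeasure μ] {A : ℝ} {j k : ℕ}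
    (hfree : 7 ≤ A * ((2 : ℝ)⁻¹ ^ j + (2 : ℝ)⁻¹ ^ k) * (1 + levelExponent j k))
    (X : Ω → ℝ) (hX : ∀ ω, X ω ≤ 7) :
    ∫⁻ ω, ENNReal.ofReal (Real.exp (levelExponent j k * X ω)) ∂μ ≤
      ENNReal.ofReal (Real.exp (levelBudget A j k)) := by
  have hl := (levelExponent_pos j k).le
  have hpt : ∀ ω, ENNReal.ofReal (Real.exp (levelExponent j k * X ω)) ≤
      ENNReal.ofReal (Real.exp (7 * levelExponent j k)) := fun ω => by
    refine ENNReal.ofReal_le_ofReal (Real.exp_le_exp.2 ?_)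
    nlinarith [hX ω]
  have h7 : 7 * levelExponent j k ≤ levelBudget A j k := by
    unfold levelBudget allowance
    have h2 : (0:ℝ) ≤ (2 : ℝ)⁻¹ ^ j + (2 : ℝ)⁻¹ ^ k := by positivity
    calc 7 * levelExponent j k
        ≤ A * ((2 : ℝ)⁻¹ ^ j + (2 : ℝ)⁻¹ ^ k) * (1 + levelExponent j k) * levelExponent j k :=
          mul_le_mul_of_nonneg_right hfree hl
      _ = A * ((2 : ℝ)⁻¹ ^ j + (2 : ℝ)⁻¹ ^ k) * (levelExponent j k + levelExponent j k ^ 2) := by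
          ring
  calc ∫⁻ ω, ENNReal.ofReal (Real.exp (levelExponent j k * X ω)) ∂μ
      ≤ ∫⁻ _ω, ENNReal.ofReal (Real.exp (7 * levelExponent j k)) ∂μ := lintegral_mono hpt
    _ = ENNReal.ofReal (Real.exp (7 * levelExponent j k)) := by simp [lintegral_const, measure_univ]
    _ ≤ ENNReal.ofReal (Real.exp (levelBudget A j k)) :=
        ENNReal.ofReal_le_ofReal (Real.exp_le_exp.2 h7)

/-- `z^{1/2} ≤ z + 1` in `[0, ∞]`. [folklore] -/
theorem rpow_half_le_add_one (z : ℝ≥0∞) : z ^ (1 / 2 : ℝ) ≤ z + 1 := by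
  rcases le_or_gt z 1 with hz | hz
  · calc z ^ (1 / 2 : ℝ) ≤ 1 ^ (1 / 2 : ℝ) := ENNReal.rpow_le_rpow hz (by norm_num)
      _ = 1 := ENNReal.one_rpow _
      _ ≤ z + 1 := le_add_self
  · calc z ^ (1 / 2 : ℝ) ≤ z ^ (1 : ℝ) :=
          ENNReal.rpow_le_rpow_of_exponent_le hz.le (by norm_num)
      _ = z := ENNReal.rpow_one z
      _ ≤ z + 1 := le_self_add

end Summit.AtomisticToContinuum.BoseEinsteinCondensation.Cruxes.LandscapeBound.SiblingTelescopingChaining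

end
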